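import Mathlib
import Summits.Ventures.PercRepro2.HalfLTwoMarkMassesA

/-!
# The masses of the `L`-half for `a₃ ~ {o, b}` in the nine cells, part B (blind cell PercRepro2, night-1 g37)

The remaining five masses of `HalfLTwoMark.lhs` by p1's double pinning (`CaseOne.prob_twoPin`), in the
vocabulary of `HalfLTwoMarkMasses`: `mass_oH` (`P(Q, o ∈ H)`), `mass_bLoH` (`P(Q, o ∈ H, b ∈ L)`),
`mass_ToU` (`P(T, o ∈ U)`), `mass_PD` (`P(PD)`), `mass_PDoU` (`P(PD, o ∈ U)`).
-/

namespace Summit.Ventures.PercRepro2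

namespace HalfLTwoMark

open CaseOne

section MassesB

variable {V : Type*} {E : Type*} [Fintype E] [DecidableEq E] {R : Type*} [CommRing R]
variable {ends : E → Sym2 V} {o b a₃ : V} {eo eb : E}

/-- **`P(Q, o ∈ H)`** for `a₃ ~ {o, b}`. -/
theorem mass_oH (p : E → R) (h : IsTwoMarkAt ends o b a₃ eo eb) {a₁ a₂ : V} (h1 : a₁ ≠ a₃)
    (h2 : a₂ ≠ a₃) :
    prob p ((connEvent ends a₁ a₂)ᶜ ∩ connEvent ends a₂ o) =
      moH (p eo) (p eb) (cellsOf p ends o a₁ a₂ b eo eb) := by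
  set p00 := Function.update (Function.update p eo 0) eb 0 with hp00
  have key := prob_twoPin p h.ne ((connEvent ends a₁ a₂)ᶜ ∩ connEvent ends a₂ o)
    (((connEvent ends a₁ a₂)ᶜ ∩ connEvent ends a₂ o ∩ (connEvent ends a₁ b)ᶜ) ∪
      ((connEvent ends a₁ a₂)ᶜ ∩ (connEvent ends a₁ o ∪ connEvent ends a₂ o)ᶜ ∩ connEvent ends a₂ b))
    ((connEvent ends a₁ a₂)ᶜ ∩ connEvent ends a₂ o) ((connEvent ends a₁ a₂)ᶜ ∩ connEvent ends a₂ o)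
    ((connEvent ends a₁ a₂)ᶜ ∩ connEvent ends a₂ o) ?_ ?_ ?_ ?_
  · rw [key]
    unfold moH cellsOf
    dsimp only
    rw [← hp00]
    have d : Disjoint ((connEvent ends a₁ a₂)ᶜ ∩ connEvent ends a₂ o ∩ (connEvent ends a₁ b)ᶜ)
        ((connEvent ends a₁ a₂)ᶜ ∩ (connEvent ends a₁ o ∪ connEvent ends a₂ o)ᶜ ∩ connEvent ends a₂ b) :=
      Set.disjoint_left.2 fun ω h1 h2 => h2.1.2 (Or.inr h1.1.2)
    rw [prob_union_of_disjoint p00 d]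
    have c := prob_inter_add_prob_inter_compl p00 ((connEvent ends a₁ a₂)ᶜ ∩ connEvent ends a₂ o)
      (connEvent ends a₁ b)
    have sb := split_b p00 ends b a₁ a₂ (connEvent ends a₂ o)
    linear_combination (p eo * p eb) * c + sb
  · intro ω ho hb
    rw [openCC_tt ho hb]
    simp only [Set.mem_compl_iff, Set.mem_inter_iff, Set.mem_union, mem_connEvent]
    rw [conn_both_iff h ω h1 h2, conn_both_iff h ω h2 h.ne_o, base2_eq_self ho hb,
      conn_comm_iff ω b a₂, conn_comm_iff ω o a₂]
    have hoo := conn_refl ends ω o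
    have t1 : Conn ends ω a₁ o → Conn ends ω a₂ o → Conn ends ω a₁ a₂ :=
      fun x y => conn_trans x (conn_symm y)
    have t2 : Conn ends ω a₁ b → Conn ends ω a₂ b → Conn ends ω a₁ a₂ :=
      fun x y => conn_trans x (conn_symm y)
    tauto
  · intro ω ho hb
    rw [openCC_tf h.ne ho hb]
    simp only [Set.mem_compl_iff, Set.mem_inter_iff, mem_connEvent]
    rw [conn_open_o_iff h ω h1 h2, conn_open_o_iff h ω h2 h.ne_o, base2_eq_self ho hb]
  · intro ω ho hb
    rw [openCC_ft ho hb]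
    simp only [Set.mem_compl_iff, Set.mem_inter_iff, mem_connEvent]
    rw [conn_open_b_iff h ω h1 h2, conn_open_b_iff h ω h2 h.ne_o, base2_eq_self ho hb]
  · intro ω ho hb
    rw [openCC_ff ho hb, base2_eq_self ho hb]

/-- **`P(Q, o ∈ H, b ∈ L)`** for `a₃ ~ {o, b}`: `(1 − r₁ r₂) HL`. -/
theorem mass_bLoH (p : E → R) (h : IsTwoMarkAt ends o b a₃ eo eb) {a₁ a₂ : V} (h1 : a₁ ≠ a₃)
    (h2 : a₂ ≠ a₃) :
    prob p ((connEvent ends a₁ a₂)ᶜ ∩ connEvent ends a₂ o ∩ connEvent ends a₁ b) =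
      mbLoH (p eo) (p eb) (cellsOf p ends o a₁ a₂ b eo eb) := by
  set p00 := Function.update (Function.update p eo 0) eb 0 with hp00
  have key := prob_twoPin p h.ne ((connEvent ends a₁ a₂)ᶜ ∩ connEvent ends a₂ o ∩ connEvent ends a₁ b)
    ∅ ((connEvent ends a₁ a₂)ᶜ ∩ connEvent ends a₂ o ∩ connEvent ends a₁ b)
    ((connEvent ends a₁ a₂)ᶜ ∩ connEvent ends a₂ o ∩ connEvent ends a₁ b)
    ((connEvent ends a₁ a₂)ᶜ ∩ connEvent ends a₂ o ∩ connEvent ends a₁ b) ?_ ?_ ?_ ?_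
  · rw [key]
    unfold mbLoH cellsOf
    dsimp only
    rw [← hp00, prob_empty]
    ring
  · intro ω ho hb
    rw [openCC_tt ho hb]
    simp only [Set.mem_compl_iff, Set.mem_inter_iff, mem_connEvent, Set.mem_empty_iff_false,
      iff_false]
    rw [conn_both_iff h ω h1 h2, conn_both_iff h ω h2 h.ne_o, conn_both_iff h ω h1 h.ne_b,
      base2_eq_self ho hb, conn_comm_iff ω b a₂, conn_comm_iff ω o a₂]
    have hoo := conn_refl ends ω o
    have hbb := conn_refl ends ω b
    have t1 : Conn ends ω a₁ o → Conn ends ω a₂ o → Conn ends ω a₁ a₂ :=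
      fun x y => conn_trans x (conn_symm y)
    have t2 : Conn ends ω a₁ b → Conn ends ω a₂ b → Conn ends ω a₁ a₂ :=
      fun x y => conn_trans x (conn_symm y)
    tauto
  · intro ω ho hb
    rw [openCC_tf h.ne ho hb]
    simp only [Set.mem_compl_iff, Set.mem_inter_iff, mem_connEvent]
    rw [conn_open_o_iff h ω h1 h2, conn_open_o_iff h ω h2 h.ne_o, conn_open_o_iff h ω h1 h.ne_b,
      base2_eq_self ho hb]
  · intro ω ho hb
    rw [openCC_ft ho hb]
    simp only [Set.mem_compl_iff, Set.mem_inter_iff, mem_connEvent]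
    rw [conn_open_b_iff h ω h1 h2, conn_open_b_iff h ω h2 h.ne_o, conn_open_b_iff h ω h1 h.ne_b,
      base2_eq_self ho hb]
  · intro ω ho hb
    rw [openCC_ff ho hb, base2_eq_self ho hb]

/-- **`P(T, o ∈ U)`** for `a₃ ~ {o, b}`. -/
theorem mass_ToU (p : E → R) (h : IsTwoMarkAt ends o b a₃ eo eb) {a₁ a₂ : V} (h1 : a₁ ≠ a₃)
    (h2 : a₂ ≠ a₃) :
    prob p ((connEvent ends a₁ a₂)ᶜ ∩ connEvent ends a₂ a₃ ∩ (connEvent ends a₁ o ∪ connEvent ends a₂ o)) =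
      mToU (p eo) (p eb) (cellsOf p ends o a₁ a₂ b eo eb) := by
  set p00 := Function.update (Function.update p eo 0) eb 0 with hp00
  have key := prob_twoPin p h.ne
    ((connEvent ends a₁ a₂)ᶜ ∩ connEvent ends a₂ a₃ ∩ (connEvent ends a₁ o ∪ connEvent ends a₂ o))
    (((connEvent ends a₁ a₂)ᶜ ∩ connEvent ends a₂ o ∩ (connEvent ends a₁ b)ᶜ) ∪
      ((connEvent ends a₁ a₂)ᶜ ∩ (connEvent ends a₁ o ∪ connEvent ends a₂ o)ᶜ ∩ connEvent ends a₂ b))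
    ((connEvent ends a₁ a₂)ᶜ ∩ connEvent ends a₂ o)
    (((connEvent ends a₁ a₂)ᶜ ∩ connEvent ends a₁ o ∩ connEvent ends a₂ b) ∪
      ((connEvent ends a₁ a₂)ᶜ ∩ connEvent ends a₂ o ∩ connEvent ends a₂ b))
    ∅ ?_ ?_ ?_ ?_
  · rw [key]
    unfold mToU cellsOf
    dsimp only
    rw [← hp00, prob_empty]
    have d : Disjoint ((connEvent ends a₁ a₂)ᶜ ∩ connEvent ends a₂ o ∩ (connEvent ends a₁ b)ᶜ)
        ((connEvent ends a₁ a₂)ᶜ ∩ (connEvent ends a₁ o ∪ connEvent ends a₂ o)ᶜ ∩ connEvent ends a₂ b) :=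
      Set.disjoint_left.2 fun ω h1 h2 => h2.1.2 (Or.inr h1.1.2)
    have d' : Disjoint ((connEvent ends a₁ a₂)ᶜ ∩ connEvent ends a₁ o ∩ connEvent ends a₂ b)
        ((connEvent ends a₁ a₂)ᶜ ∩ connEvent ends a₂ o ∩ connEvent ends a₂ b) :=
      Set.disjoint_left.2 fun ω h1 h2 => not_both h1.1.1 h1.1.2 h2.1.2
    rw [prob_union_of_disjoint p00 d, prob_union_of_disjoint p00 d']
    have c := prob_inter_add_prob_inter_compl p00 ((connEvent ends a₁ a₂)ᶜ ∩ connEvent ends a₂ o)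
      (connEvent ends a₁ b)
    have sb := split_b p00 ends b a₁ a₂ (connEvent ends a₂ o)
    linear_combination (p eo * p eb) * c + p eo * sb
  · intro ω ho hb
    rw [openCC_tt ho hb]
    simp only [Set.mem_compl_iff, Set.mem_inter_iff, Set.mem_union, mem_connEvent]
    rw [conn_both_iff h ω h1 h2, conn_both_a3_iff h ω h2, conn_both_iff h ω h1 h.ne_o,
      conn_both_iff h ω h2 h.ne_o, base2_eq_self ho hb, conn_comm_iff ω b a₂, conn_comm_iff ω o a₂]
    have hoo := conn_refl ends ω o
    have t1 : Conn ends ω a₁ o → Conn ends ω a₂ o → Conn ends ω a₁ a₂ :=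
      fun x y => conn_trans x (conn_symm y)
    have t2 : Conn ends ω a₁ b → Conn ends ω a₂ b → Conn ends ω a₁ a₂ :=
      fun x y => conn_trans x (conn_symm y)
    tauto
  · intro ω ho hb
    rw [openCC_tf h.ne ho hb]
    simp only [Set.mem_compl_iff, Set.mem_inter_iff, Set.mem_union, mem_connEvent]
    rw [conn_open_o_iff h ω h1 h2, conn_open_o_a3_iff h ω h2, conn_open_o_iff h ω h1 h.ne_o,
      conn_open_o_iff h ω h2 h.ne_o, base2_eq_self ho hb]
    tauto
  · intro ω ho hb
    rw [openCC_ft ho hb]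
    simp only [Set.mem_compl_iff, Set.mem_inter_iff, Set.mem_union, mem_connEvent]
    rw [conn_open_b_iff h ω h1 h2, conn_open_b_a3_iff h ω h2, conn_open_b_iff h ω h1 h.ne_o,
      conn_open_b_iff h ω h2 h.ne_o, base2_eq_self ho hb]
    tauto
  · intro ω ho hb
    rw [openCC_ff ho hb]
    simp only [Set.mem_compl_iff, Set.mem_inter_iff, Set.mem_union, mem_connEvent,
      Set.mem_empty_iff_false, iff_false]
    exact fun hc => not_conn_base2 h ω h2 hc.1.2

/-- **`P(PD) = P(Q, a₃ ∉ U)`** for `a₃ ~ {o, b}`. -/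
theorem mass_PD (p : E → R) (h : IsTwoMarkAt ends o b a₃ eo eb) {a₁ a₂ : V} (h1 : a₁ ≠ a₃)
    (h2 : a₂ ≠ a₃) :
    prob p ((connEvent ends a₁ a₂)ᶜ ∩ (connEvent ends a₃ a₁ ∪ connEvent ends a₃ a₂)ᶜ) =
      mPD (p eo) (p eb) (cellsOf p ends o a₁ a₂ b eo eb) := by
  set p00 := Function.update (Function.update p eo 0) eb 0 with hp00
  have key := prob_twoPin p h.ne
    ((connEvent ends a₁ a₂)ᶜ ∩ (connEvent ends a₃ a₁ ∪ connEvent ends a₃ a₂)ᶜ)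
    ((connEvent ends a₁ a₂)ᶜ ∩ (connEvent ends a₁ o ∪ connEvent ends a₂ o)ᶜ ∩
      (connEvent ends a₁ b ∪ connEvent ends a₂ b)ᶜ)
    ((connEvent ends a₁ a₂)ᶜ ∩ (connEvent ends a₁ o ∪ connEvent ends a₂ o)ᶜ)
    ((connEvent ends a₁ a₂)ᶜ ∩ (connEvent ends a₁ b ∪ connEvent ends a₂ b)ᶜ)
    (connEvent ends a₁ a₂)ᶜ ?_ ?_ ?_ ?_
  · rw [key]
    unfold mPD cellsOf
    dsimp only
    rw [← hp00]
    have sb := split_b p00 ends b a₁ a₂ (connEvent ends a₁ o ∪ connEvent ends a₂ o)ᶜ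
    have so := split_o p00 ends o a₁ a₂ (connEvent ends a₁ b ∪ connEvent ends a₂ b)ᶜ
    have tot := total_cells p00 ends o b a₁ a₂
    linear_combination (p eo * (1 - p eb)) * sb + ((1 - p eo) * p eb) * so +
      ((1 - p eo) * (1 - p eb)) * tot
  · intro ω ho hb
    rw [openCC_tt ho hb]
    simp only [Set.mem_compl_iff, Set.mem_inter_iff, Set.mem_union, mem_connEvent]
    rw [conn_both_iff h ω h1 h2, conn_comm_iff _ a₃ a₁, conn_comm_iff _ a₃ a₂,
      conn_both_a3_iff h ω h1, conn_both_a3_iff h ω h2, base2_eq_self ho hb,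
      conn_comm_iff ω b a₂, conn_comm_iff ω o a₂]
    tauto
  · intro ω ho hb
    rw [openCC_tf h.ne ho hb]
    simp only [Set.mem_compl_iff, Set.mem_inter_iff, Set.mem_union, mem_connEvent]
    rw [conn_open_o_iff h ω h1 h2, conn_comm_iff _ a₃ a₁, conn_comm_iff _ a₃ a₂,
      conn_open_o_a3_iff h ω h1, conn_open_o_a3_iff h ω h2, base2_eq_self ho hb]
  · intro ω ho hb
    rw [openCC_ft ho hb]
    simp only [Set.mem_compl_iff, Set.mem_inter_iff, Set.mem_union, mem_connEvent]
    rw [conn_open_b_iff h ω h1 h2, conn_comm_iff _ a₃ a₁, conn_comm_iff _ a₃ a₂,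
      conn_open_b_a3_iff h ω h1, conn_open_b_a3_iff h ω h2, base2_eq_self ho hb]
  · intro ω ho hb
    rw [openCC_ff ho hb, base2_eq_self ho hb]
    simp only [Set.mem_compl_iff, Set.mem_inter_iff, Set.mem_union, mem_connEvent]
    constructor
    · exact fun hc => hc.1
    · intro hq
      refine ⟨hq, ?_⟩
      rintro (hc | hc)
      · exact h1 (isolated_of_closed h ho hb hc)
      · exact h2 (isolated_of_closed h ho hb hc)

/-- **`P(PD, o ∈ U)`** for `a₃ ~ {o, b}`. -/
theorem mass_PDoU (p : E → R) (h : IsTwoMarkAt ends o b a₃ eo eb) {a₁ a₂ : V} (h1 : a₁ ≠ a₃)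
    (h2 : a₂ ≠ a₃) :
    prob p ((connEvent ends a₁ a₂)ᶜ ∩ (connEvent ends a₃ a₁ ∪ connEvent ends a₃ a₂)ᶜ ∩
        (connEvent ends a₁ o ∪ connEvent ends a₂ o)) =
      mPDoU (p eo) (p eb) (cellsOf p ends o a₁ a₂ b eo eb) := by
  set p00 := Function.update (Function.update p eo 0) eb 0 with hp00
  have key := prob_twoPin p h.ne
    ((connEvent ends a₁ a₂)ᶜ ∩ (connEvent ends a₃ a₁ ∪ connEvent ends a₃ a₂)ᶜ ∩
        (connEvent ends a₁ o ∪ connEvent ends a₂ o))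
    ∅ ∅
    (((connEvent ends a₁ a₂)ᶜ ∩ connEvent ends a₁ o ∩ (connEvent ends a₁ b ∪ connEvent ends a₂ b)ᶜ) ∪
      ((connEvent ends a₁ a₂)ᶜ ∩ connEvent ends a₂ o ∩ (connEvent ends a₁ b ∪ connEvent ends a₂ b)ᶜ))
    (((connEvent ends a₁ a₂)ᶜ ∩ connEvent ends a₁ o) ∪ ((connEvent ends a₁ a₂)ᶜ ∩ connEvent ends a₂ o))
    ?_ ?_ ?_ ?_
  · rw [key]
    unfold mPDoU cellsOf
    dsimp only
    rw [← hp00, prob_empty]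
    have d : Disjoint ((connEvent ends a₁ a₂)ᶜ ∩ connEvent ends a₁ o ∩
          (connEvent ends a₁ b ∪ connEvent ends a₂ b)ᶜ)
        ((connEvent ends a₁ a₂)ᶜ ∩ connEvent ends a₂ o ∩ (connEvent ends a₁ b ∪ connEvent ends a₂ b)ᶜ) :=
      Set.disjoint_left.2 fun ω h1 h2 => not_both h1.1.1 h1.1.2 h2.1.2
    have d' : Disjoint ((connEvent ends a₁ a₂)ᶜ ∩ connEvent ends a₁ o)
        ((connEvent ends a₁ a₂)ᶜ ∩ connEvent ends a₂ o) :=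
      Set.disjoint_left.2 fun ω h1 h2 => not_both h1.1 h1.2 h2.2
    rw [prob_union_of_disjoint p00 d, prob_union_of_disjoint p00 d']
    have s1 := split_b p00 ends b a₁ a₂ (connEvent ends a₁ o)
    have s2 := split_b p00 ends b a₁ a₂ (connEvent ends a₂ o)
    linear_combination ((1 - p eo) * (1 - p eb)) * (s1 + s2)
  · intro ω ho hb
    rw [openCC_tt ho hb]
    simp only [Set.mem_compl_iff, Set.mem_inter_iff, Set.mem_union, mem_connEvent,
      Set.mem_empty_iff_false, iff_false]
    rw [conn_both_iff h ω h1 h2, conn_comm_iff _ a₃ a₁, conn_comm_iff _ a₃ a₂,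
      conn_both_a3_iff h ω h1, conn_both_a3_iff h ω h2, conn_both_iff h ω h1 h.ne_o,
      conn_both_iff h ω h2 h.ne_o, base2_eq_self ho hb, conn_comm_iff ω b a₂, conn_comm_iff ω o a₂]
    have hoo := conn_refl ends ω o
    tauto
  · intro ω ho hb
    rw [openCC_tf h.ne ho hb]
    simp only [Set.mem_compl_iff, Set.mem_inter_iff, Set.mem_union, mem_connEvent,
      Set.mem_empty_iff_false, iff_false]
    rw [conn_open_o_iff h ω h1 h2, conn_comm_iff _ a₃ a₁, conn_comm_iff _ a₃ a₂,
      conn_open_o_a3_iff h ω h1, conn_open_o_a3_iff h ω h2, conn_open_o_iff h ω h1 h.ne_o,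
      conn_open_o_iff h ω h2 h.ne_o, base2_eq_self ho hb]
    tauto
  · intro ω ho hb
    rw [openCC_ft ho hb]
    simp only [Set.mem_compl_iff, Set.mem_inter_iff, Set.mem_union, mem_connEvent]
    rw [conn_open_b_iff h ω h1 h2, conn_comm_iff _ a₃ a₁, conn_comm_iff _ a₃ a₂,
      conn_open_b_a3_iff h ω h1, conn_open_b_a3_iff h ω h2, conn_open_b_iff h ω h1 h.ne_o,
      conn_open_b_iff h ω h2 h.ne_o, base2_eq_self ho hb]
    tauto
  · intro ω ho hb
    rw [openCC_ff ho hb, base2_eq_self ho hb]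
    simp only [Set.mem_compl_iff, Set.mem_inter_iff, Set.mem_union, mem_connEvent]
    have n1 : ¬ Conn ends ω a₃ a₁ := fun hc => h1 (isolated_of_closed h ho hb hc)
    have n2 : ¬ Conn ends ω a₃ a₂ := fun hc => h2 (isolated_of_closed h ho hb hc)
    tauto

end MassesB

end HalfLTwoMark

end Summit.Ventures.PercRepro2
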